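import Mathlib.Analysis.Calculus.Rademacher
import Mathlib.Analysis.Calculus.FDeriv.Measurable
import Literature.Geometry.Lorentzian.InverseMeanCurvatureFlowProofs
import Literature.Geometry.Lorentzian.VolumeChartIntegral
import Literature.Geometry.Lorentzian.VolumeProofs
import Literature.Geometry.Lorentzian.ChartLaplacian
import HarnessLib

/-!
# Inverse mean curvature flow I — proofs: the slope of a locally Lipschitz function

Sorry-free lemmas on the objects of `InverseMeanCurvatureFlow.lean` (Huisken–Ilmanen,
J. Differential Geom. 59 (2001), §1): the analytic groundwork which makes the level-set energy
`J_u^K(v) = ∫_K |∇v| + v |∇u| dμ_h` (`imcfEnergy`) of *locally Lipschitz* functions an honest,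
finite integral, as Huisken–Ilmanen use tacitly throughout §§1–3 ("`∇u` is defined a.e.",
"local Lipschitz bounds give local bounds for `|∇u|`"). Everything is proved; there are no
definitions and no named facts.

* **The slope in a chart** (`gradNorm_sq_eq_sum_chart`): on the domain of the chart `φ` at `x₀`,
  `|∇u|²(p) = ∑ₖₗ hᵏˡ(p) ∂ₖû(φ p) ∂ₗû(φ p)` with `û = u ∘ φ⁻¹` (O'Neill 1983, Ch. 3, p. 60), for
  *every* `u : X → ℝ` — both sides vanish where `u` is not differentiable
  (`mdifferentiableAt_iff_differentiableAt_chart`, `mfderiv_apply_localFrame`).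
* **Measurability** (`aemeasurable_gradNorm`, `aestronglyMeasurable_gradNorm`): the slope of any
  function is a.e.-measurable for the Riemannian measure `μ_h` (the Fréchet derivative of any
  function is Borel, Mathlib's `measurable_fderiv`; the inverse metric `hᵏˡ` is smooth on chart
  domains, `contMDiffOn_gram_localFrame_inv`; countably many chart domains cover `X`).
* **Lipschitz bound** (`abs_mfderiv_le_of_lipschitzOnWith`, `gradNorm_le_of_lipschitzOnWith`):
  if `u` is `K`-Lipschitz for the Riemannian distance near `p` then `|du_p(v)| ≤ K ‖v‖_p` and
  `|∇u|(p) ≤ K`; the proof runs the difference quotient along a chart line and uses that charts are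
  `C`-bi-Lipschitz for the length distance for every `C > 1` after linearization
  (`exists_nhds_riemannianEDist_le_and_edist_le` of `VolumeChartFormula.lean`, Burago–Burago–Ivanov
  2001, §5.1). Hence `|∇u|` is locally bounded on `Ω` and bounded on compact `K ⊆ Ω` for `u`
  locally Lipschitz on the open set `Ω` (`IsLocLipschitzOn.exists_nhds_gradNorm_le`,
  `IsLocLipschitzOn.exists_forall_gradNorm_le`).
* **Rademacher's theorem on the manifold** (`IsLocLipschitzOn.ae_mdifferentiableAt`): a locally
  Lipschitz `u` on an open `Ω` is differentiable at `μ_h`-a.e. point of `Ω` — `u ∘ φ⁻¹` is Lipschitz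
  in charts (`IsLocLipschitzOn.exists_lipschitzOnWith_chart`), Mathlib's Rademacher theorem
  (`LipschitzOnWith.ae_differentiableWithinAt_of_mem`; Federer 1969, 3.1.6) applies there, and
  Lebesgue-null sets of the chart are `μ_h`-null (`riemannianMeasure_source_inter_preimage_eq_zero`,
  from the chart formula `map_extChartAt_restrict_riemannianMeasure` of `VolumeChartIntegral.lean`).
* **Integrability** (`IsLocLipschitzOn.integrableOn_gradNorm`, `integrableOn_mul_gradNorm`,
  `integrableOn_imcfEnergy_integrand`, `imcfEnergy_eq_integral_add`): for `u, v` locally Lipschitz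
  on the open set `Ω` and `K ⊆ Ω` compact, `|∇u|`, `v|∇u|` and `|∇v| + v|∇u|` are `μ_h`-integrable
  on `K` and `J_u^K(v) = ∫_K |∇v| + ∫_K v|∇u|`.

These are the first steps of the functional (charts-and-Rademacher, no BV theory) route to the
Uniqueness Theorem 2.2 of Huisken–Ilmanen inside the named fact `weak_existence`
(`InverseMeanCurvatureFlow.lean`); the a.e. calculus of `max/min` of Lipschitz functions, (1.18),
and Thm. 2.2 itself are not in this file.

## References

* G. Huisken, T. Ilmanen, *The inverse mean curvature flow and the Riemannian Penrose
  inequality*, J. Differential Geom. 59 (2001) 353–437: §1 (the functional `J_u^K`, (1.5); `∇u`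
  a.e. for locally Lipschitz `u`).
* H. Federer, *Geometric Measure Theory*, Springer 1969, 3.1.6 (Rademacher's theorem), §3.2.46.
* D. Burago, Yu. Burago, S. Ivanov, *A course in metric geometry*, AMS 2001, §5.1 (charts are
  locally bi-Lipschitz for the length metric).
* B. O'Neill, *Semi-Riemannian geometry*, Academic Press 1983, Ch. 3, p. 60 (`g^{ij}`, `|du|²`).
-/

noncomputable section

open Bundle Set Manifold TopologicalSpace Filter MeasureTheory Function
open scoped ContDiff Topology ENNReal NNReal Manifold Real

namespace Literature.Geometry.Lorentzian

open PseudoRiemannianMetric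

variable {X : Type*} [TopologicalSpace X] [ChartedSpace E3 X] [IsManifold (𝓡 3) ∞ X]

/-! ### Differentiability and the slope in a chart -/

section Chart

variable (h : ContMDiffRiemannianMetric (𝓡 3) ∞ E3 (TangentSpace (𝓡 3) : X → Type _))

omit [IsManifold (𝓡 3) ∞ X] in
/-- On the domain of the chart at `x₀`, a function agrees near each point with its chart
representative composed with the chart: `u = (u ∘ φ⁻¹) ∘ φ` near `p`. [folklore] -/
theorem eventuallyEq_comp_extChartAt {u : X → ℝ} {x₀ p : X} (hp : p ∈ (chartAt E3 x₀).source) :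
    u =ᶠ[𝓝 p] (u ∘ (extChartAt (𝓡 3) x₀).symm) ∘ extChartAt (𝓡 3) x₀ := by
  have hps : (extChartAt (𝓡 3) x₀).source ∈ 𝓝 p := by
    rw [extChartAt_source]; exact (chartAt E3 x₀).open_source.mem_nhds hp
  filter_upwards [hps] with q hq
  simp only [Function.comp_apply, (extChartAt (𝓡 3) x₀).left_inv hq]

/-- **Differentiability is read in any chart**: for `p` in the domain of the chart `φ` at `x₀`,
`u` is (manifold-)differentiable at `p` iff its representative `u ∘ φ⁻¹` is differentiable at
`φ p` (the continuity clause of `MDifferentiableAt` is automatic for functions to `ℝ`).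
[folklore] -/
theorem mdifferentiableAt_iff_differentiableAt_chart {u : X → ℝ} {x₀ p : X}
    (hp : p ∈ (chartAt E3 x₀).source) :
    MDifferentiableAt (𝓡 3) 𝓘(ℝ, ℝ) u p ↔
      DifferentiableAt ℝ (u ∘ (extChartAt (𝓡 3) x₀).symm) (extChartAt (𝓡 3) x₀ p) := by
  rw [mdifferentiableAt_iff_of_mem_source (I' := 𝓘(ℝ, ℝ)) (x := x₀) (y := u p) hp
    (mem_chart_source ℝ (u p))]
  simp only [extChartAt_model_space_eq_id, PartialEquiv.refl_coe, Function.id_comp,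
    ModelWithCorners.Boundaryless.range_eq_univ, differentiableWithinAt_univ, and_iff_right_iff_imp]
  intro hd
  have hc : ContinuousAt ((u ∘ (extChartAt (𝓡 3) x₀).symm) ∘ extChartAt (𝓡 3) x₀) p :=
    hd.continuousAt.comp (continuousAt_extChartAt' (by rwa [extChartAt_source]))
  exact hc.congr (eventuallyEq_comp_extChartAt hp).symm

/-- If `u` is not differentiable at a point `p` of the chart domain of `x₀`, the Fréchet derivative
of its chart representative at `φ p` is the junk value `0`. [folklore] -/
theorem fderiv_chart_eq_zero_of_not_mdifferentiableAt {u : X → ℝ} {x₀ p : X}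
    (hp : p ∈ (chartAt E3 x₀).source) (hu : ¬ MDifferentiableAt (𝓡 3) 𝓘(ℝ, ℝ) u p) :
    fderiv ℝ (u ∘ (extChartAt (𝓡 3) x₀).symm) (extChartAt (𝓡 3) x₀ p) = 0 :=
  fderiv_zero_of_not_differentiableAt
    (fun hd ↦ hu ((mdifferentiableAt_iff_differentiableAt_chart hp).2 hd))

/-- **The differential along a coordinate vector is a partial derivative of the representative**,
unconditionally: `du_p(∂ᵢ) = D(u ∘ φ⁻¹)(φ p) bᵢ` for every `u` (both sides vanish when `u` is not
differentiable at `p`). [folklore] -/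
theorem mfderiv_apply_localFrame {ι : Type*} (b : Module.Basis ι ℝ E3) {u : X → ℝ} {x₀ p : X}
    (hp : p ∈ (chartAt E3 x₀).source) (i : ι) :
    mfderiv (𝓡 3) 𝓘(ℝ, ℝ) u p
        ((trivializationAt E3 (TangentSpace (𝓡 3)) x₀).localFrame b i p) =
      fderiv ℝ (u ∘ (extChartAt (𝓡 3) x₀).symm) (extChartAt (𝓡 3) x₀ p) (b i) := by
  by_cases hu : MDifferentiableAt (𝓡 3) 𝓘(ℝ, ℝ) u p
  · exact mvfderiv_apply_localFrame b hp hu i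
  · rw [mfderiv_zero_of_not_mdifferentiableAt hu, fderiv_chart_eq_zero_of_not_mdifferentiableAt hp hu]
    rfl

/-- The inverse metric is nonnegative on the diagonal: `h⁻¹(α, α) = |♯α|² ≥ 0` (a file-local copy
of `innerDual_self_nonneg` of `GreenIdentity.lean`, to keep the imports of this file small).
[folklore] -/
private theorem innerDual_self_nonneg' (p : X) (α : Module.Dual ℝ (TangentSpace (𝓡 3) p)) :
    0 ≤ (ofRiemannian h).innerDual p α α := by
  rw [innerDual_eq_val_sharp_sharp, val_ofRiemannian]
  set w := (ofRiemannian h).sharp p α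
  by_cases hw : w = 0
  · simp [hw]
  · exact (h.pos p w hw).le

/-- **The slope in a chart.** For `p` in the domain of the chart `φ` at `x₀` and any basis `b` of
the model space, `|∇u|²(p) = ∑ₗ ∑ₖ hᵏˡ(p) ∂ₖû(φ p) ∂ₗû(φ p)`, where `û = u ∘ φ⁻¹`,
`∂ₖû = Dû(bₖ)` and `(hᵏˡ)` is the inverse of the Gram matrix `h(∂ᵢ, ∂ⱼ)` of the coordinate frame
`∂ᵢ` (O'Neill 1983, Ch. 3, p. 60: `|du|² = g^{ij} ∂ᵢu ∂ⱼu`). Valid for every `u : X → ℝ` (both sides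
vanish where `u` is not differentiable). [folklore] -/
theorem gradNorm_sq_eq_sum_chart {ι : Type*} [Fintype ι] [DecidableEq ι] (b : Module.Basis ι ℝ E3)
    {u : X → ℝ} {x₀ p : X} (hp : p ∈ (chartAt E3 x₀).source) :
    gradNorm h u p ^ 2 = ∑ l, ∑ k,
      (Matrix.of fun i j ↦ (ofRiemannian h).val p
        ((trivializationAt E3 (TangentSpace (𝓡 3)) x₀).localFrame b i p)
        ((trivializationAt E3 (TangentSpace (𝓡 3)) x₀).localFrame b j p))⁻¹ k l *
      fderiv ℝ (u ∘ (extChartAt (𝓡 3) x₀).symm) (extChartAt (𝓡 3) x₀ p) (b k) *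
      fderiv ℝ (u ∘ (extChartAt (𝓡 3) x₀).symm) (extChartAt (𝓡 3) x₀ p) (b l) := by
  rw [gradNorm, Real.sq_sqrt (innerDual_self_nonneg' h p _),
    innerDual_eq_sum_localFrame (ofRiemannian h) b hp]
  refine Finset.sum_congr rfl (fun l _ ↦ Finset.sum_congr rfl (fun k _ ↦ ?_))
  rw [← mfderiv_apply_localFrame b hp k, ← mfderiv_apply_localFrame b hp l]
  rfl

end Chart

/-! ### The slope of a Lipschitz function is bounded by the Lipschitz constant -/

section LipschitzBound

variable (h : ContMDiffRiemannianMetric (𝓡 3) ∞ E3 (TangentSpace (𝓡 3) : X → Type _))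
  [T2Space X] [LocallyCompactSpace X]

omit [IsManifold (𝓡 3) ∞ X] [T2Space X] [LocallyCompactSpace X] in
/-- The `ℝ`-valued differential `mvfderiv` (Mathlib's `d% u`) and `mfderiv` agree pointwise (the
identification `T_{u p} ℝ = ℝ`, `NormedSpace.fromTangentSpace`, is the identity). [folklore] -/
theorem mvfderiv_apply_eq_mfderiv (u : X → ℝ) (p : X) (v : TangentSpace (𝓡 3) p) :
    mvfderiv (𝓡 3) u p v = mfderiv (𝓡 3) 𝓘(ℝ, ℝ) u p v := rfl

set_option backward.isDefEq.respectTransparency false in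
/-- **The differential of a Lipschitz function is bounded by the Lipschitz constant**: if `u` is
`K`-Lipschitz for the Riemannian distance on a neighbourhood of `p`, then `|du_p(v)| ≤ K ‖v‖_p`
for every tangent vector `v`. Proof: for `C > 1` the chart at `p` is `C`-bi-Lipschitz near `p`
after the linearization `A` (`exists_nhds_riemannianEDist_le_and_edist_le`), so along the chart
line `t ↦ φ⁻¹(φ p + t v)` one has `|u(q_t) - u(p)| ≤ K d(q_t, p) ≤ K C t ‖v‖_p`, while the
difference quotient tends to `du_p(v)`; let `C → 1`. [folklore] -/
theorem abs_mfderiv_le_of_lipschitzOnWith {u : X → ℝ} {p : X} {K : ℝ≥0} {t : Set X}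
    (ht : t ∈ 𝓝 p)
    (hu : letI : RiemannianBundle (fun x : X ↦ TangentSpace (𝓡 3) x) :=
        ⟨h.toContinuousRiemannianMetric.toRiemannianMetric⟩
      letI : PseudoEMetricSpace X := .ofRiemannianMetric (𝓡 3) X
      LipschitzOnWith K u t)
    (v : TangentSpace (𝓡 3) p) :
    letI : RiemannianBundle (fun x : X ↦ TangentSpace (𝓡 3) x) :=
      ⟨h.toContinuousRiemannianMetric.toRiemannianMetric⟩
    |mvfderiv (𝓡 3) u p v| ≤ K * ‖v‖ := by
  letI : RiemannianBundle (fun x : X ↦ TangentSpace (𝓡 3) x) :=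
    ⟨h.toContinuousRiemannianMetric.toRiemannianMetric⟩
  letI : PseudoEMetricSpace X := .ofRiemannianMetric (𝓡 3) X
  -- it suffices to prove the bound with an extra factor `C > 1`
  suffices key : ∀ C : ℝ≥0, 1 < C → |mvfderiv (𝓡 3) u p v| ≤ K * C * ‖v‖ by
    have hT : Tendsto (fun C : ℝ≥0 ↦ (K : ℝ) * C * ‖v‖) (𝓝[>] 1) (𝓝 ((K : ℝ) * (1 : ℝ≥0) * ‖v‖)) :=
      ((by fun_prop : Continuous fun C : ℝ≥0 ↦ (K : ℝ) * C * ‖v‖).tendsto 1).mono_left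
        nhdsWithin_le_nhds
    rw [NNReal.coe_one, mul_one] at hT
    exact ge_of_tendsto hT (eventually_nhdsWithin_of_forall key)
  intro C hC
  rw [mvfderiv_apply_eq_mfderiv]
  by_cases hd : MDifferentiableAt (𝓡 3) 𝓘(ℝ, ℝ) u p
  swap
  · rw [mfderiv_zero_of_not_mdifferentiableAt hd]
    change |(0 : ℝ)| ≤ K * C * ‖v‖
    simp only [abs_zero]; positivity
  -- the chart at `p`, a linearization `A` at `p`, and the bi-Lipschitz neighbourhood `U`
  set φ := extChartAt (𝓡 3) p with hφ
  obtain ⟨A, hA⟩ := exists_norm_eq_norm_symmL (I := 𝓡 3) p p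
  obtain ⟨U, hU, hUsrc, hle, -⟩ :=
    exists_nhds_riemannianEDist_le_and_edist_le (I := 𝓡 3) p p (mem_chart_source E3 p) hA hC
  -- `‖A w‖ = ‖w‖_p`: the trivialization at `p` is the identity on the fibre at `p`
  have hsymm : ∀ w : E3, (trivializationAt E3 (TangentSpace (𝓡 3)) p).symmL ℝ p w =
      (w : TangentSpace (𝓡 3) p) := by
    intro w
    rw [TangentBundle.symmL_trivializationAt (mem_chart_source E3 p),
      mfderivWithin_range_extChartAt_symm]
    rfl
  -- the chart line through `p` in the direction `v`
  set w : E3 := v with hw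
  have hAv : ‖A w‖ = ‖v‖ := by rw [hA w, hsymm w, hw]
  set c : ℝ → E3 := fun s ↦ φ p + s • w with hc
  have hc0 : c 0 = φ p := by simp [hc]
  have hcd : HasDerivAt c w 0 := by
    simpa [hc] using ((hasDerivAt_id (0 : ℝ)).smul_const w).const_add (φ p)
  -- `u ∘ φ⁻¹` has derivative `du_p` at `φ p`
  have h1 : HasFDerivAt (u ∘ φ.symm) (mfderiv (𝓡 3) 𝓘(ℝ, ℝ) u p) (φ p) := by
    have h0 := hd.hasMFDerivAt.2
    simp only [writtenInExtChartAt, extChartAt_model_space_eq_id, PartialEquiv.refl_coe,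
      Function.id_comp, ModelWithCorners.Boundaryless.range_eq_univ, hasFDerivWithinAt_univ] at h0
    exact h0
  have h2 : HasDerivAt ((u ∘ φ.symm) ∘ c) (mfderiv (𝓡 3) 𝓘(ℝ, ℝ) u p w) 0 :=
    h1.comp_hasDerivAt_of_eq 0 hcd hc0.symm
  have h3 := h2.tendsto_slope_zero_right
  -- along `𝓝[>] 0`: the points `q_s = φ⁻¹ (c s)` lie in `U ∩ t` and `c s ∈ φ.target`
  have hct : ContinuousAt c 0 := hcd.continuousAt
  have hq : Tendsto (fun s ↦ φ.symm (c s)) (𝓝 0) (𝓝 p) := by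
    have h' : ContinuousAt φ.symm (c 0) := by rw [hc0]; exact continuousAt_extChartAt_symm p
    have := h'.tendsto.comp hct.tendsto
    simpa [Function.comp_def, hc0, hφ] using this
  have hev : ∀ᶠ s in 𝓝[>] (0 : ℝ),
      |s⁻¹ • (((u ∘ φ.symm) ∘ c) (0 + s) - ((u ∘ φ.symm) ∘ c) 0)| ≤ K * C * ‖v‖ := by
    have htm : φ.target ∈ 𝓝 (c 0) := by
      rw [hc0]; exact (isOpen_extChartAt_target p).mem_nhds (mem_extChartAt_target p)
    have htarget : ∀ᶠ s in 𝓝 (0 : ℝ), c s ∈ φ.target := hct.preimage_mem_nhds htm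
    have hUt : ∀ᶠ s in 𝓝 (0 : ℝ), φ.symm (c s) ∈ U ∩ t := hq (inter_mem hU ht)
    filter_upwards [nhdsWithin_le_nhds htarget, nhdsWithin_le_nhds hUt, self_mem_nhdsWithin]
      with s hs hsU hs0
    rw [zero_add]
    have hs0' : (0 : ℝ) < s := hs0
    have hp' : φ.symm (c 0) = p := by rw [hc0]; exact extChartAt_to_inv p
    have hpU : p ∈ U ∩ t := ⟨mem_of_mem_nhds hU, mem_of_mem_nhds ht⟩
    -- Lipschitz estimate and chart comparison
    have hdist : riemannianEDist (𝓡 3) (φ.symm (c s)) p ≤ C * ‖A (c s) - A (φ p)‖ₑ := by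
      have := hle _ hsU.1 _ hpU.1
      rwa [edist_eq_enorm_sub, (extChartAt (𝓡 3) p).right_inv hs] at this
    have hAc : ‖A (c s) - A (φ p)‖ = s * ‖v‖ := by
      rw [← map_sub, show c s - φ p = s • w by simp [hc], map_smul, norm_smul, hAv,
        Real.norm_of_nonneg hs0'.le]
    have hlip : |u (φ.symm (c s)) - u p| ≤ K * (C * (s * ‖v‖)) := by
      have h4 := hu hsU.2 hpU.2
      change edist (u (φ.symm (c s))) (u p) ≤ K * riemannianEDist (𝓡 3) (φ.symm (c s)) p at h4
      have h5 : edist (u (φ.symm (c s))) (u p) ≤ K * (C * ‖A (c s) - A (φ p)‖ₑ) :=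
        h4.trans (by gcongr)
      rw [edist_dist, Real.dist_eq, ← ofReal_norm, hAc, ← ENNReal.ofReal_coe_nnreal,
        ← ENNReal.ofReal_coe_nnreal, ← ENNReal.ofReal_mul (by positivity),
        ← ENNReal.ofReal_mul (by positivity)] at h5
      exact (ENNReal.ofReal_le_ofReal_iff (by positivity)).1 h5
    simp only [Function.comp_apply, hp', smul_eq_mul]
    rw [abs_mul, abs_inv, abs_of_pos hs0']
    calc s⁻¹ * |u (φ.symm (c s)) - u p| ≤ s⁻¹ * (K * (C * (s * ‖v‖))) := by gcongr
      _ = K * C * ‖v‖ := by field_simp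
  have h4 : Tendsto (fun s ↦ |s⁻¹ • (((u ∘ φ.symm) ∘ c) (0 + s) - ((u ∘ φ.symm) ∘ c) 0)|)
      (𝓝[>] (0 : ℝ)) (𝓝 |mfderiv (𝓡 3) 𝓘(ℝ, ℝ) u p w|) := (continuous_abs.tendsto _).comp h3
  exact le_of_tendsto h4 hev

set_option backward.isDefEq.respectTransparency false in
/-- **The slope of a Lipschitz function is at most the Lipschitz constant**: if `u` is
`K`-Lipschitz for the Riemannian distance on a neighbourhood of `p` then `|∇u|(p) ≤ K`
(`|∇u|(p) = |du_p|_{h*} = ‖♯du_p‖_p` and `|∇u|² = du_p(♯du_p) ≤ K ‖♯du_p‖_p`). Huisken–Ilmanen use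
this in the form "local Lipschitz bounds give local bounds for `|∇u|`" throughout §§1–3.
[folklore] -/
theorem gradNorm_le_of_lipschitzOnWith {u : X → ℝ} {p : X} {K : ℝ≥0} {t : Set X}
    (ht : t ∈ 𝓝 p)
    (hu : letI : RiemannianBundle (fun x : X ↦ TangentSpace (𝓡 3) x) :=
        ⟨h.toContinuousRiemannianMetric.toRiemannianMetric⟩
      letI : PseudoEMetricSpace X := .ofRiemannianMetric (𝓡 3) X
      LipschitzOnWith K u t) :
    gradNorm h u p ≤ K := by
  letI : RiemannianBundle (fun x : X ↦ TangentSpace (𝓡 3) x) :=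
    ⟨h.toContinuousRiemannianMetric.toRiemannianMetric⟩
  set α : Module.Dual ℝ (TangentSpace (𝓡 3) p) := (mfderiv (𝓡 3) 𝓘(ℝ, ℝ) u p).toLinearMap
    with hα
  set w : TangentSpace (𝓡 3) p := (ofRiemannian h).sharp p α with hw_def
  have hsq : gradNorm h u p ^ 2 = α w := by
    rw [gradNorm, Real.sq_sqrt (innerDual_self_nonneg' h p _)]
    rfl
  have hnorm : ‖w‖ ^ 2 = α w := by
    rw [← real_inner_self_eq_norm_sq]
    change h.inner p w w = α w
    rw [← val_ofRiemannian, hw_def, val_sharp_apply]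
  have hwn : ‖w‖ = gradNorm h u p := by
    have h1 : ‖w‖ ^ 2 = gradNorm h u p ^ 2 := by rw [hnorm, hsq]
    exact (sq_eq_sq₀ (norm_nonneg _) (gradNorm_nonneg h u p)).1 h1
  have hb : α w ≤ (K : ℝ) * ‖w‖ :=
    (le_abs_self (α w)).trans (abs_mfderiv_le_of_lipschitzOnWith h ht hu w)
  rw [hwn, ← hsq] at hb
  by_cases h0 : gradNorm h u p = 0
  · rw [h0]; positivity
  · have hpos : 0 < gradNorm h u p := lt_of_le_of_ne (gradNorm_nonneg h u p) (Ne.symm h0)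
    nlinarith

/-- **Local slope bounds for locally Lipschitz functions**: if `u` is locally Lipschitz (for the
Riemannian distance) on an open set `Ω`, every point of `Ω` has a neighbourhood on which `|∇u|`
is bounded. [folklore] -/
theorem IsLocLipschitzOn.exists_nhds_gradNorm_le {u : X → ℝ} {Ω : Set X}
    (hu : IsLocLipschitzOn h u Ω) (hΩ : IsOpen Ω) {p : X} (hp : p ∈ Ω) :
    ∃ C : ℝ≥0, ∃ U ∈ 𝓝 p, ∀ q ∈ U, gradNorm h u q ≤ C := by
  letI : RiemannianBundle (fun x : X ↦ TangentSpace (𝓡 3) x) :=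
    ⟨h.toContinuousRiemannianMetric.toRiemannianMetric⟩
  letI : PseudoEMetricSpace X := .ofRiemannianMetric (𝓡 3) X
  obtain ⟨K, t, ht, hK⟩ := (show LocallyLipschitzOn Ω u from hu) hp
  rw [hΩ.nhdsWithin_eq hp] at ht
  refine ⟨K, interior t, interior_mem_nhds.2 ht, fun q hq ↦ ?_⟩
  exact gradNorm_le_of_lipschitzOnWith h (isOpen_interior.mem_nhds hq)
    (hK.mono interior_subset)

/-- **`|∇u|` is bounded on compact subsets** of an open set on which `u` is locally Lipschitz
(finite subcover of the local bounds). This is why `J_u^K(v) = ∫_K |∇v| + v|∇u|` is a genuine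
(finite) integral for locally Lipschitz `u, v` and compact `K`. [folklore] -/
theorem IsLocLipschitzOn.exists_forall_gradNorm_le {u : X → ℝ} {Ω K : Set X}
    (hu : IsLocLipschitzOn h u Ω) (hΩ : IsOpen Ω) (hK : IsCompact K) (hKΩ : K ⊆ Ω) :
    ∃ C : ℝ≥0, ∀ q ∈ K, gradNorm h u q ≤ C := by
  choose! C U hU hCU using fun p (hp : p ∈ Ω) ↦ hu.exists_nhds_gradNorm_le h hΩ hp
  obtain ⟨T, hTK, hKT⟩ := hK.elim_nhds_subcover U (fun p hp ↦ hU p (hKΩ hp))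
  classical
  refine ⟨T.sup (fun p ↦ C p), fun q hq ↦ ?_⟩
  obtain ⟨p, hpT, hqU⟩ : ∃ p ∈ T, q ∈ U p := by
    have hq' : q ∈ ⋃ x ∈ T, U x := hKT hq
    simp only [mem_iUnion, exists_prop] at hq'
    obtain ⟨p, hpT, hq''⟩ := hq'
    exact ⟨p, hpT, hq''⟩
  have h1 : gradNorm h u q ≤ C p := hCU p (hKΩ (hTK p hpT)) q hqU
  exact h1.trans (NNReal.coe_le_coe.2 (Finset.le_sup (f := fun p ↦ C p) hpT))

end LipschitzBound

/-! ### Measurability of the slope -/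

section Measurable

variable (h : ContMDiffRiemannianMetric (𝓡 3) ∞ E3 (TangentSpace (𝓡 3) : X → Type _))
  [T2Space X] [LocallyCompactSpace X] [MeasurableSpace X] [BorelSpace X]

/-- **The slope is a.e.-measurable on every chart domain**, for an arbitrary function `u`: by
`gradNorm_sq_eq_sum_chart` it is there the square root of a finite sum of products of the
continuous inverse-metric coefficients `hᵏˡ` with the partial derivatives `∂ₖ(u ∘ φ⁻¹) ∘ φ`, and
the Fréchet derivative of *any* function is Borel measurable (Mathlib's `measurable_fderiv`).
[folklore] -/
theorem aemeasurable_gradNorm_restrict_source (u : X → ℝ) (x₀ : X) :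
    AEMeasurable (gradNorm h u) ((riemannianMeasure h).restrict (chartAt E3 x₀).source) := by
  classical
  set b : Module.Basis (Fin 3) ℝ E3 := (EuclideanSpace.basisFun (Fin 3) ℝ).toBasis with hb
  set μ := riemannianMeasure h with hμ
  have hS : MeasurableSet (chartAt E3 x₀).source := (chartAt E3 x₀).open_source.measurableSet
  have hφ : AEMeasurable (extChartAt (𝓡 3) x₀) (μ.restrict (chartAt E3 x₀).source) := by
    have := aemeasurable_extChartAt_restrict (I := 𝓡 3) x₀ μ
    rwa [extChartAt_source] at this
  have hD : ∀ k, AEMeasurable (fun p ↦ fderiv ℝ (u ∘ (extChartAt (𝓡 3) x₀).symm)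
      (extChartAt (𝓡 3) x₀ p) (b k)) (μ.restrict (chartAt E3 x₀).source) := fun k ↦
    (measurable_fderiv_apply_const ℝ (u ∘ (extChartAt (𝓡 3) x₀).symm) (b k)).comp_aemeasurable hφ
  have hG : ∀ k l, AEMeasurable (fun p ↦ (Matrix.of fun i j ↦ (ofRiemannian h).val p
      ((trivializationAt E3 (TangentSpace (𝓡 3)) x₀).localFrame b i p)
      ((trivializationAt E3 (TangentSpace (𝓡 3)) x₀).localFrame b j p))⁻¹ k l)
      (μ.restrict (chartAt E3 x₀).source) := by
    intro k l
    have hc : ContinuousOn (fun p ↦ (Matrix.of fun i j ↦ (ofRiemannian h).val p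
        ((trivializationAt E3 (TangentSpace (𝓡 3)) x₀).localFrame b i p)
        ((trivializationAt E3 (TangentSpace (𝓡 3)) x₀).localFrame b j p))⁻¹ k l)
        (trivializationAt E3 (TangentSpace (𝓡 3)) x₀).baseSet :=
      (contMDiffOn_gram_localFrame_inv (trivializationAt E3 (TangentSpace (𝓡 3)) x₀)
        (ofRiemannian h) b k l).continuousOn
    rw [TangentBundle.trivializationAt_baseSet] at hc
    exact hc.aemeasurable hS
  have hF : AEMeasurable (fun p ↦ Real.sqrt (∑ l, ∑ k,
      (Matrix.of fun i j ↦ (ofRiemannian h).val p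
        ((trivializationAt E3 (TangentSpace (𝓡 3)) x₀).localFrame b i p)
        ((trivializationAt E3 (TangentSpace (𝓡 3)) x₀).localFrame b j p))⁻¹ k l *
      fderiv ℝ (u ∘ (extChartAt (𝓡 3) x₀).symm) (extChartAt (𝓡 3) x₀ p) (b k) *
      fderiv ℝ (u ∘ (extChartAt (𝓡 3) x₀).symm) (extChartAt (𝓡 3) x₀ p) (b l)))
      (μ.restrict (chartAt E3 x₀).source) := by
    refine Real.continuous_sqrt.measurable.comp_aemeasurable ?_
    refine Finset.aemeasurable_fun_sum _ (fun l _ ↦ Finset.aemeasurable_fun_sum _ (fun k _ ↦ ?_))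
    exact ((hG k l).mul (hD k)).mul (hD l)
  refine hF.congr ?_
  filter_upwards [ae_restrict_mem hS] with p hp
  have hsq := gradNorm_sq_eq_sum_chart h b (u := u) hp
  rw [← hsq, Real.sqrt_sq (gradNorm_nonneg h u p)]

variable [SecondCountableTopology X]

/-- **The slope of any function is a.e.-measurable** for the Riemannian measure (countably many
chart domains cover `X`). [folklore] -/
theorem aemeasurable_gradNorm (u : X → ℝ) : AEMeasurable (gradNorm h u) (riemannianMeasure h) := by
  obtain ⟨T, hTc, hT⟩ := TopologicalSpace.countable_cover_nhds
    (fun x : X ↦ (chartAt E3 x).open_source.mem_nhds (mem_chart_source E3 x))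
  haveI := hTc.to_subtype
  rw [← Measure.restrict_univ (μ := riemannianMeasure h), ← hT, biUnion_eq_iUnion]
  exact aemeasurable_iUnion_iff.2 fun x ↦ aemeasurable_gradNorm_restrict_source h u x

/-- The slope of any function is a.e.-strongly measurable for the Riemannian measure. [folklore] -/
theorem aestronglyMeasurable_gradNorm (u : X → ℝ) :
    AEStronglyMeasurable (gradNorm h u) (riemannianMeasure h) :=
  (aemeasurable_gradNorm h u).aestronglyMeasurable

end Measurable

/-! ### Rademacher's theorem on the manifold -/

section Rademacher

variable (h : ContMDiffRiemannianMetric (𝓡 3) ∞ E3 (TangentSpace (𝓡 3) : X → Type _))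
  [T2Space X] [LocallyCompactSpace X]

/-- **Locally Lipschitz for the Riemannian distance ⟹ Lipschitz in charts.** If `u` is locally
Lipschitz on the open set `Ω` then every `p ∈ Ω` has an open neighbourhood `U ⊆ Ω` inside the
domain of the chart `φ` at `p` such that the representative `u ∘ φ⁻¹` is Lipschitz on `φ(U)` for the
Euclidean distance: charts are locally bi-Lipschitz for the length distance
(`exists_nhds_riemannianEDist_le_and_edist_le`, Burago–Burago–Ivanov 2001, §5.1). This is the
"equivalently, Lipschitz in charts" of the definition of `IsLocLipschitzOn`. [folklore] -/
theorem IsLocLipschitzOn.exists_lipschitzOnWith_chart {u : X → ℝ} {Ω : Set X}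
    (hu : IsLocLipschitzOn h u Ω) (hΩ : IsOpen Ω) {p : X} (hp : p ∈ Ω) :
    ∃ U : Set X, IsOpen U ∧ p ∈ U ∧ U ⊆ Ω ∧ U ⊆ (extChartAt (𝓡 3) p).source ∧
      ∃ K : ℝ≥0, LipschitzOnWith K (u ∘ (extChartAt (𝓡 3) p).symm) (extChartAt (𝓡 3) p '' U) := by
  letI : RiemannianBundle (fun x : X ↦ TangentSpace (𝓡 3) x) :=
    ⟨h.toContinuousRiemannianMetric.toRiemannianMetric⟩
  letI : PseudoEMetricSpace X := .ofRiemannianMetric (𝓡 3) X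
  obtain ⟨K, t, ht, hK⟩ := (show LocallyLipschitzOn Ω u from hu) hp
  rw [hΩ.nhdsWithin_eq hp] at ht
  obtain ⟨A, hA⟩ := exists_norm_eq_norm_symmL (I := 𝓡 3) p p
  obtain ⟨U₁, hU₁, hU₁src, hle, -⟩ := exists_nhds_riemannianEDist_le_and_edist_le (I := 𝓡 3) p p
    (mem_chart_source E3 p) hA one_lt_two
  have hsrc : interior (t ∩ U₁ ∩ Ω) ⊆ (extChartAt (𝓡 3) p).source := by
    rw [extChartAt_source]; exact interior_subset.trans fun q hq ↦ hU₁src hq.1.2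
  refine ⟨interior (t ∩ U₁ ∩ Ω), isOpen_interior, ?_, interior_subset.trans inter_subset_right,
    hsrc, K * (2 * ‖A‖₊), ?_⟩
  · exact mem_interior_iff_mem_nhds.2 (inter_mem (inter_mem ht hU₁) (hΩ.mem_nhds hp))
  · rintro _ ⟨q, hq, rfl⟩ _ ⟨q', hq', rfl⟩
    have hqU := interior_subset hq
    have hq'U := interior_subset hq'
    simp only [Function.comp_apply, (extChartAt (𝓡 3) p).left_inv (hsrc hq),
      (extChartAt (𝓡 3) p).left_inv (hsrc hq')]
    calc edist (u q) (u q') ≤ K * edist q q' := hK hqU.1.1 hq'U.1.1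
      _ ≤ K * ((2 : ℝ≥0) * edist (A (extChartAt (𝓡 3) p q)) (A (extChartAt (𝓡 3) p q'))) := by
        gcongr
        exact hle q hqU.1.2 q' hq'U.1.2
      _ ≤ K * ((2 : ℝ≥0) * (‖A‖₊ * edist (extChartAt (𝓡 3) p q) (extChartAt (𝓡 3) p q'))) := by
        gcongr
        exact A.lipschitz.edist_le_mul _ _
      _ = (K * (2 * ‖A‖₊) : ℝ≥0) * edist (extChartAt (𝓡 3) p q) (extChartAt (𝓡 3) p q') := by
        push_cast; ring

variable [MeasurableSpace X] [BorelSpace X]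

/-- **Lebesgue-null sets in a chart are null for the Riemannian measure**: if `B ⊆ ℝ³` is a
measurable Lebesgue-null set then `φ.source ∩ φ⁻¹(B)` is `μ_h`-null, `φ` the extended chart at
`x₀` (the push-forward of `μ_h|_{φ.source}` under `φ` has the density `√det h_{ij}` with respect to
Lebesgue measure, `map_extChartAt_restrict_riemannianMeasure`). [folklore] -/
theorem riemannianMeasure_source_inter_preimage_eq_zero (x₀ : X) {B : Set E3}
    (hB : MeasurableSet B) (hB0 : volume B = 0) :
    riemannianMeasure h ((extChartAt (𝓡 3) x₀).source ∩ extChartAt (𝓡 3) x₀ ⁻¹' B) = 0 := by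
  have hs : MeasurableSet (extChartAt (𝓡 3) x₀).source :=
    (isOpen_extChartAt_source x₀).measurableSet
  rw [inter_comm, ← Measure.restrict_apply' hs,
    ← Measure.map_apply_of_aemeasurable (aemeasurable_extChartAt_restrict x₀ _) hB,
    map_extChartAt_restrict_riemannianMeasure h x₀, withDensity_apply _ hB,
    Measure.restrict_restrict hB]
  exact setLIntegral_measure_zero _ _ (measure_inter_null_of_null_left _ hB0)

variable [SecondCountableTopology X]

/-- **Rademacher's theorem on a Riemannian `3`-manifold.** A function locally Lipschitz (for the
Riemannian distance) on an open set `Ω` is differentiable at `μ_h`-almost every point of `Ω`: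
in a chart `u ∘ φ⁻¹` is Lipschitz (`exists_lipschitzOnWith_chart`), hence differentiable
Lebesgue-a.e. (Rademacher's theorem, Mathlib's `LipschitzOnWith.ae_differentiableWithinAt_of_mem`;
Federer 1969, 3.1.6), differentiability of `u` at `q` is differentiability of `u ∘ φ⁻¹` at `φ q`,
and Lebesgue-null sets are `μ_h`-null (`riemannianMeasure_source_inter_preimage_eq_zero`);
countably many such chart neighbourhoods cover `Ω`. Huisken–Ilmanen 2001 use this tacitly
throughout §1 ("`∇u` defined a.e."). [cite: HuiskenIlmanenIMCF2001, §1 (weak formulation, ∇u a.e.)] -/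
theorem IsLocLipschitzOn.ae_mdifferentiableAt {u : X → ℝ} {Ω : Set X}
    (hu : IsLocLipschitzOn h u Ω) (hΩ : IsOpen Ω) :
    ∀ᵐ p ∂(riemannianMeasure h), p ∈ Ω → MDifferentiableAt (𝓡 3) 𝓘(ℝ, ℝ) u p := by
  -- local statement around each point of `Ω`
  have hloc : ∀ p ∈ Ω, ∃ U ∈ 𝓝[Ω] p, ∀ᵐ q ∂(riemannianMeasure h).restrict U,
      MDifferentiableAt (𝓡 3) 𝓘(ℝ, ℝ) u q := by
    intro p hp
    obtain ⟨U, hUo, hpU, -, hUs, K, hK⟩ := hu.exists_lipschitzOnWith_chart h hΩ hp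
    refine ⟨U, mem_nhdsWithin_of_mem_nhds (hUo.mem_nhds hpU), ?_⟩
    -- the chart image of `U` is open
    have hS : IsOpen (extChartAt (𝓡 3) p '' U) := by
      rw [(extChartAt (𝓡 3) p).image_eq_target_inter_inv_preimage hUs]
      exact (continuousOn_extChartAt_symm p).isOpen_inter_preimage (isOpen_extChartAt_target p) hUo
    -- Rademacher in `ℝ³`
    have hR : ∀ᵐ y ∂(volume : Measure E3), y ∈ extChartAt (𝓡 3) p '' U →
        DifferentiableAt ℝ (u ∘ (extChartAt (𝓡 3) p).symm) y := by
      filter_upwards [hK.ae_differentiableWithinAt_of_mem (μ := volume)] with y hy hyS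
      exact (hy hyS).differentiableAt (hS.mem_nhds hyS)
    -- the exceptional set in the chart is Lebesgue-null
    set B := {y | ¬ DifferentiableAt ℝ (u ∘ (extChartAt (𝓡 3) p).symm) y} ∩
      extChartAt (𝓡 3) p '' U with hB
    have hBm : MeasurableSet B :=
      (measurableSet_of_differentiableAt ℝ (u ∘ (extChartAt (𝓡 3) p).symm)).compl.inter
        hS.measurableSet
    have hB0 : volume B = 0 := by
      rw [measure_eq_zero_iff_ae_notMem]
      filter_upwards [hR] with y hy hyB
      exact hyB.1 (hy hyB.2)
    have hnull := riemannianMeasure_source_inter_preimage_eq_zero h p hBm hB0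
    -- hence the exceptional set of `u` in `U` is `μ_h`-null
    rw [ae_restrict_iff' hUo.measurableSet, ae_iff]
    refine measure_mono_null (fun q hq ↦ ?_) hnull
    simp only [Classical.not_imp, mem_setOf_eq] at hq
    obtain ⟨hqU, hqd⟩ := hq
    have hqs : q ∈ (chartAt E3 p).source := by rw [← extChartAt_source (𝓡 3)]; exact hUs hqU
    refine ⟨hUs hqU, ?_⟩
    simp only [mem_preimage, hB, mem_inter_iff, mem_setOf_eq]
    exact ⟨fun hd ↦ hqd ((mdifferentiableAt_iff_differentiableAt_chart hqs).2 hd),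
      mem_image_of_mem _ hqU⟩
  -- countably many such neighbourhoods cover `Ω`
  choose! U hU hUae using hloc
  obtain ⟨T, hTΩ, hTc, hcover⟩ := TopologicalSpace.countable_cover_nhdsWithin hU
  have h1 : ∀ᵐ q ∂(riemannianMeasure h).restrict (⋃ x ∈ T, U x),
      MDifferentiableAt (𝓡 3) 𝓘(ℝ, ℝ) u q :=
    (ae_restrict_biUnion_iff U hTc _).2 fun x hx ↦ hUae x (hTΩ hx)
  exact (ae_restrict_iff' hΩ.measurableSet).1 (ae_restrict_of_ae_restrict_of_subset hcover h1)

end Rademacher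

/-! ### Integrability of the slope; the energy is a sum of two finite integrals -/

section Integrable

variable (h : ContMDiffRiemannianMetric (𝓡 3) ∞ E3 (TangentSpace (𝓡 3) : X → Type _))
  [T2Space X] [LocallyCompactSpace X] [MeasurableSpace X] [BorelSpace X]
  [SecondCountableTopology X]

/-- **`|∇u|` is integrable on compact subsets** of an open set on which `u` is locally Lipschitz:
it is a.e.-measurable (`aestronglyMeasurable_gradNorm`), bounded on `K`
(`exists_forall_gradNorm_le`), and compact sets have finite Riemannian measure
(`riemannianVolume_lt_top_of_isCompact_holds`). [folklore] -/
theorem IsLocLipschitzOn.integrableOn_gradNorm {u : X → ℝ} {Ω K : Set X}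
    (hu : IsLocLipschitzOn h u Ω) (hΩ : IsOpen Ω) (hK : IsCompact K) (hKΩ : K ⊆ Ω) :
    IntegrableOn (gradNorm h u) K (riemannianMeasure h) := by
  obtain ⟨C, hC⟩ := hu.exists_forall_gradNorm_le h hΩ hK hKΩ
  refine Measure.integrableOn_of_bounded
    (riemannianVolume_lt_top_of_isCompact_holds h le_rfl hK).ne
    (aestronglyMeasurable_gradNorm h u) (M := C) ?_
  filter_upwards [ae_restrict_mem hK.measurableSet] with q hq
  rw [Real.norm_of_nonneg (gradNorm_nonneg h u q)]
  exact hC q hq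

/-- `v |∇u|` is integrable on a compact `K ⊆ Ω` for `u` locally Lipschitz on the open set `Ω` and
`v` continuous on `K`. [folklore] -/
theorem IsLocLipschitzOn.integrableOn_mul_gradNorm {u v : X → ℝ} {Ω K : Set X}
    (hu : IsLocLipschitzOn h u Ω) (hΩ : IsOpen Ω) (hK : IsCompact K) (hKΩ : K ⊆ Ω)
    (hv : ContinuousOn v K) :
    IntegrableOn (fun x ↦ v x * gradNorm h u x) K (riemannianMeasure h) :=
  (hu.integrableOn_gradNorm h hΩ hK hKΩ).continuousOn_mul hv hK

/-- **Huisken–Ilmanen's energy is a genuine integral.** For `u, v` locally Lipschitz on the open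
set `Ω` and `K ⊆ Ω` compact, `J_u^K(v) = ∫_K |∇v| + ∫_K v |∇u|` with both integrals finite
(so the Bochner integral defining `imcfEnergy` takes no junk value). Huisken–Ilmanen 2001, §1,
the functional `J_u^K` before (1.5). [cite: HuiskenIlmanenIMCF2001, §1 (1.5)] -/
theorem imcfEnergy_eq_integral_add {u v : X → ℝ} {Ω K : Set X}
    (hu : IsLocLipschitzOn h u Ω) (hv : IsLocLipschitzOn h v Ω) (hΩ : IsOpen Ω)
    (hK : IsCompact K) (hKΩ : K ⊆ Ω) :
    imcfEnergy h u K v = (∫ x in K, gradNorm h v x ∂riemannianMeasure h) +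
      ∫ x in K, v x * gradNorm h u x ∂riemannianMeasure h :=
  integral_add (hv.integrableOn_gradNorm h hΩ hK hKΩ)
    (hu.integrableOn_mul_gradNorm h hΩ hK hKΩ ((hv.continuousOn h).mono hKΩ))

/-- The integrand `|∇v| + v|∇u|` of `J_u^K(v)` is integrable on compact `K ⊆ Ω` for `u, v` locally
Lipschitz on the open set `Ω`. [cite: HuiskenIlmanenIMCF2001, §1 (1.5)] -/
theorem integrableOn_imcfEnergy_integrand {u v : X → ℝ} {Ω K : Set X}
    (hu : IsLocLipschitzOn h u Ω) (hv : IsLocLipschitzOn h v Ω) (hΩ : IsOpen Ω)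
    (hK : IsCompact K) (hKΩ : K ⊆ Ω) :
    IntegrableOn (fun x ↦ gradNorm h v x + v x * gradNorm h u x) K (riemannianMeasure h) :=
  (hv.integrableOn_gradNorm h hΩ hK hKΩ).add
    (hu.integrableOn_mul_gradNorm h hΩ hK hKΩ ((hv.continuousOn h).mono hKΩ))

/-- **A.e. differentiability, restricted form**: `u` locally Lipschitz on the open set `Ω` is
differentiable `μ_h|_Ω`-almost everywhere. [cite: HuiskenIlmanenIMCF2001, §1 (weak formulation, ∇u a.e.)] -/
theorem IsLocLipschitzOn.ae_restrict_mdifferentiableAt {u : X → ℝ} {Ω : Set X}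
    (hu : IsLocLipschitzOn h u Ω) (hΩ : IsOpen Ω) :
    ∀ᵐ p ∂(riemannianMeasure h).restrict Ω, MDifferentiableAt (𝓡 3) 𝓘(ℝ, ℝ) u p :=
  (ae_restrict_iff' hΩ.measurableSet).2 (hu.ae_mdifferentiableAt h hΩ)

end Integrable

end Literature.Geometry.Lorentzian

end
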